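import Summits.Ventures.CertifiedManyBodySolver.Observables.KineticWordD4
import HarnessLib

/-!
# Ventures/CertifiedManyBodySolver — Observables/SWavePairWordD4.lean

HONEST FRAMING: first certified bounds; not a superconductivity verdict; every number certified or labelled float.
(cell hubbard-algo, seat hubbard-box-eng-3 g4; theorem-only support — apart from three abbrevs — for typing the `func:Ps_r1_0` BOX WORDS of the
box-dual product `boxdual/0` as `D₄`-orbit rows, `BOXDUAL-FORMAT.md` §17; zero compute, no certificate, no named fact, no `sorry`.)

**The ON-SITE s-WAVE PAIR two-point word and its `D₄` transport.** The op-08 menu functional `Ps_r1_0` of the oplayer formulation-A bundles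
(functionals.json: «Re omega(Delta*_0 Delta_r), Delta_x = c_{x,dn} c_{x,up} (on-site s-wave pair correlator), r = (1, 0)»; terms
`½ c†_{0↑}c†_{0↓}c_{r↓}c_{r↑} + ½ (adjoint)`) is `Re ω(Δ₀ᴴ Δ_r)` with `Δ_x = c_{x,1} c_{x,0}`, read in the G-averaged state (translations × `D₄` × spin
flip × adjoint). This file types the word `sPairWord r = Δ₀ᴴ Δ_r ∈ 𝔄_{{0,r}}` (the product is insensitive to the spin-label convention and to the
order inside `Δ`: both flips change the sign twice) and proves its transport under `Γ(d4Emb γ 0)`: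
`Re ω_{γΛ}(Γ_γ (Δ₀ᴴ Δ_r)) = Re ω_{{0,γr}}(Δ₀ᴴ Δ_{γr})` (`re_expect_d4Emb_sPairWord`), hence the `D₄`-orbit mean of an orbit row on `sPairWord r` is
`|S|⁻¹ Σ_{γ∈S} Re ω(Δ₀ᴴ Δ_{γr})` (`re_orbitMean_sPairWord_eq`) — for `r = (1,0)` the axis class `{(±1,0), (0,±1)}`. A certificate on `±Ps_r1_0` over a
parameter cell is then the orbit LOWER box row `SquareTTPrimeCorrOrbitLowerBoxRow lo hi cap q univ (sPairRegion r) (±sPairWord r)` (`Rows/DopedTLCorrBox.lean`).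
References: Scalapino, Phys. Rep. 250 (1995) 329, §2 [Scalapino1995]; Bratteli–Robinson II §6.2.4 [BratteliRobinsonII1997].
-/

noncomputable section

namespace Summit.Ventures.CertifiedManyBodySolver.Observables

open Literature.MathematicalPhysics.QuantumLattice
open Literature.MathematicalPhysics.QuantumLattice.ThermodynamicLimit
open Literature.Probability.LatticeModels
open Summit.Ventures.CertifiedManyBodySolver.Transport
open Matrix Finset Filter Topology HubbardWave0
open scoped Matrix BigOperators ComplexOrder

/-! ## §0 The word -/

/-- The two-point region `{0, r}`. [folklore] -/
abbrev sPairRegion (r : Site 2) : Finset (Site 2) := {0, r}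

/-- The on-site pair `Δ_x = c_{x,1} c_{x,0}` at a site `x ∈ Λ`. [cite: Scalapino1995, §2] -/
abbrev sPairAt (Λ : Finset (Site 2)) (x : Site 2) (hx : x ∈ Λ) : FermionOp Λ :=
  cAt x hx 1 * cAt x hx 0

/-- **The on-site s-wave pair two-point word** `Δ₀ᴴ Δ_r ∈ 𝔄_{{0,r}}`; `Re ω(sPairWord r)` is the op-08 functional `Ps_r<a>_<b>` at `r = (a,b)`.
[cite: Scalapino1995, §2] -/
abbrev sPairWord (r : Site 2) : FermionOp (sPairRegion r) :=
  (sPairAt (sPairRegion r) 0 (mem_insert_self _ _))ᴴ * sPairAt (sPairRegion r) r (mem_insert_of_mem (mem_singleton_self _))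

/-! ## §1 Transport under `D₄` -/

/-- Transport of the s-wave pair word: `Re ω_{γΛ}(Γ(d4Emb γ 0 Λ)(Δ₀ᴴ Δ_r)) = Re ω_{{0,γr}}(Δ₀ᴴ Δ_{γr})` (`Γ(d4Emb) c_{xσ} = c_{γx,σ}`, isotony).
[cite: BratteliRobinsonII1997, §6.2.4] -/
theorem re_expect_d4Emb_sPairWord (ω : InfVolFermionState 2) (γ : DihedralGroup 4) (r : Site 2) :
    (ω.expect (d4ShiftSet γ 0 (sPairRegion r)) (fermionEmbed (PolySite.d4Emb γ 0 (sPairRegion r)) (sPairWord r))).re =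
      (ω.expect (sPairRegion (d4Vec γ r)) (sPairWord (d4Vec γ r))).re := by
  have h0 : d4Vec γ (0 : Site 2) + 0 = 0 := by rw [add_zero, (d4Vec_eq_zero_iff γ 0).2 rfl]
  have hv : d4Vec γ r + 0 = d4Vec γ r := add_zero _
  have hsub : (sPairRegion (d4Vec γ r)) ⊆ d4ShiftSet γ 0 (sPairRegion r) := by
    intro z hz
    rcases mem_insert.1 hz with rfl | hz
    · have h := d4Vec_add_mem_d4ShiftSet γ 0 (mem_insert_self (0 : Site 2) ({r} : Finset (Site 2)))
      rwa [h0] at h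
    · rw [mem_singleton.1 hz]
      have h := d4Vec_add_mem_d4ShiftSet γ 0 (mem_insert_of_mem (mem_singleton_self r) : r ∈ sPairRegion r)
      rwa [hv] at h
  have h1 : ∀ σ : Fin 2, fermionEmbed (PolySite.d4Emb γ 0 (sPairRegion r)) (cAt 0 (mem_insert_self _ _) σ) =
      cAt 0 (hsub (mem_insert_self _ _)) σ := fun σ =>
    (fermionEmbed_annihilation _ _ _).trans (cAt_congr (d4Vec_add_mem_d4ShiftSet γ 0 (mem_insert_self _ _)) _ h0 σ)
  have h2 : ∀ σ : Fin 2, fermionEmbed (PolySite.d4Emb γ 0 (sPairRegion r)) (cAt r (mem_insert_of_mem (mem_singleton_self _)) σ) =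
      cAt (d4Vec γ r) (hsub (mem_insert_of_mem (mem_singleton_self _))) σ := fun σ =>
    (fermionEmbed_annihilation _ _ _).trans (cAt_congr (d4Vec_add_mem_d4ShiftSet γ 0 (mem_insert_of_mem (mem_singleton_self _))) _ hv σ)
  have hw : fermionEmbed (PolySite.d4Emb γ 0 (sPairRegion r)) (sPairWord r) =
      fermionEmbed (PolySite.incl hsub) (sPairWord (d4Vec γ r)) := by
    rw [show (sPairWord r : FermionOp (sPairRegion r)) =
        (cAt 0 (mem_insert_self _ _) 1 * cAt 0 (mem_insert_self _ _) 0)ᴴ *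
          (cAt r (mem_insert_of_mem (mem_singleton_self _)) 1 * cAt r (mem_insert_of_mem (mem_singleton_self _)) 0) from rfl,
      show (sPairWord (d4Vec γ r) : FermionOp (sPairRegion (d4Vec γ r))) =
        (cAt 0 (mem_insert_self _ _) 1 * cAt 0 (mem_insert_self _ _) 0)ᴴ *
          (cAt (d4Vec γ r) (mem_insert_of_mem (mem_singleton_self _)) 1 *
            cAt (d4Vec γ r) (mem_insert_of_mem (mem_singleton_self _)) 0) from rfl]
    simp only [map_mul, fermionEmbed_conjTranspose, fermionEmbed_incl_cAt, h1, h2]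
  rw [hw, ω.compatible hsub]

/-- **The `D₄`-orbit mean of the transported s-wave pair word is the orbit mean of the named correlator**:
`|S|⁻¹ Σ_{γ∈S} Re ω_{γΛ}(Γ(d4Emb γ 0 Λ)(Δ₀ᴴ Δ_r)) = |S|⁻¹ Σ_{γ∈S} Re ω(Δ₀ᴴ Δ_{γr})`. [cite: Scalapino1995, §2] -/
theorem re_orbitMean_sPairWord_eq (ω : InfVolFermionState 2) (S : Finset (DihedralGroup 4)) (r : Site 2) :
    (S.card : ℝ)⁻¹ * ∑ γ ∈ S,
        (ω.expect (d4ShiftSet γ 0 (sPairRegion r)) (fermionEmbed (PolySite.d4Emb γ 0 (sPairRegion r)) (sPairWord r))).re =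
      (S.card : ℝ)⁻¹ * ∑ γ ∈ S, (ω.expect (sPairRegion (d4Vec γ r)) (sPairWord (d4Vec γ r))).re :=
  congrArg (fun s : ℝ => (S.card : ℝ)⁻¹ * s) (Finset.sum_congr rfl fun γ _ => re_expect_d4Emb_sPairWord ω γ r)

/-- Linearity for the upper edge: the orbit sum of the NEGATED transported word is minus the orbit sum. [folklore] -/
theorem re_orbitSum_neg_sPairWord (ω : InfVolFermionState 2) (S : Finset (DihedralGroup 4)) (r : Site 2) :
    ∑ γ ∈ S, (ω.expect (d4ShiftSet γ 0 (sPairRegion r)) (fermionEmbed (PolySite.d4Emb γ 0 (sPairRegion r)) (-sPairWord r))).re =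
      -∑ γ ∈ S, (ω.expect (d4ShiftSet γ 0 (sPairRegion r)) (fermionEmbed (PolySite.d4Emb γ 0 (sPairRegion r)) (sPairWord r))).re := by
  rw [← Finset.sum_neg_distrib]
  refine Finset.sum_congr rfl fun γ _ => ?_
  rw [map_neg, map_neg, Complex.neg_re]

end Summit.Ventures.CertifiedManyBodySolver.Observables

end
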